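import Summits.AtomisticToContinuum.Crystallization.Theorems.FrustratedLawDichotomyCellF1Pos
import Summits.AtomisticToContinuum.Crystallization.Theorems.FrustratedLawDichotomyCellF1cHost
import Summits.AtomisticToContinuum.Crystallization.Theorems.FrustratedLawDichotomyCellF1cLists

/-!
# FrustratedLawDichotomy · crux `AperiodicFrustratedLawGap` (stmt-AtomisticToContinuum-27623) — class-A K-file tower, layers 2e-c / 2g-c:
INTERIOR placement facts and the rule-G5 POSITIONAL facts over the COMPLETE template `MF1c` (KFILE amendment E2/E4, critic r1861; hand-2 g48)

#90 `…CellF1Interior` + #92 `…CellF1Pos` RE-BASED on #106 `MF1c` / #112 `…CellF1cHost` / #113 `…CellF1cLists`: every per-label hypothesis of the (251)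
master `lb_le_certFloorL_scale` that quantifies over the LABEL SET, restated on the named column `aF1` over `MF1c` — separation `hsep_aF1c`, the
norm ceiling `norm_Mc_le_aF1` (`‖a_F m‖ ≤ 13 + 41/1024` on `MF1c`: `(1 + 3ε)·BLc/2²⁸ ≤ (13 + 41/1024)²` — complete labels may sit beyond the window, by
design), window completeness `hout_aF1c` at `RwF1c = Rc + τ`, the mirror-host side condition `hnbh_aF1c` / `hnbh_aF1c_const` (any `L ≤ RwF1c − 4`, e.g.
`L = 9`), the interior-in-ball fact `MI_subset_ballLc` (`ℓ_A := 40`), and the far conversions `far_aF1c` / `dist_aF1c`.  Interior facts (`norm_MI_le_aF1`,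
`hint_aF1`, `sqT_le_of_MI`) are #90/#92's — `MIF1` is unchanged.
Imports TREE #92 `…CellF1Pos` + #112 + #113; 0 sorry.  Tags: [new: K-file layer]; nothing here closes an item.
-/

namespace Summit.AtomisticToContinuum.Crystallization.Theorems.FrustratedLawDichotomyCellF1cPos

open scoped BigOperators
open Summit.AtomisticToContinuum.Crystallization.Theorems.FrustratedLawDichotomyCellMetric (posL)
open Summit.AtomisticToContinuum.Crystallization.Theorems.FrustratedLawDichotomyCellClasses (ballL)
open Summit.AtomisticToContinuum.Crystallization.Theorems.FrustratedLawDichotomyCellData (norm_le_of_nearId)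
open Summit.AtomisticToContinuum.Crystallization.Theorems.FrustratedLawDichotomyCellTriples (zT sumT sqT subT mem_ballL_zT)
open Summit.AtomisticToContinuum.Crystallization.Theorems.FrustratedLawDichotomyCellHostMirror (mirrorNbh mirT)
open Summit.AtomisticToContinuum.Crystallization.Theorems.FrustratedLawDichotomyCellF1Frame (T qk sumSq_T)
open Summit.AtomisticToContinuum.Crystallization.Theorems.FrustratedLawDichotomyCellF1Labels (MIF1)
open Summit.AtomisticToContinuum.Crystallization.Theorems.FrustratedLawDichotomyCellF1cLabels (MF1c BLc admLc_iff mem_Mc MI_subset_Mc hsepc)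
open Summit.AtomisticToContinuum.Crystallization.Theorems.FrustratedLawDichotomyCellF1Pos (aF1 aF1_eq norm_MI_le_aF1)
open Summit.AtomisticToContinuum.Crystallization.Theorems.FrustratedLawDichotomyCellF1Interior (norm_MI_le sqT_le_of_MI)
open Summit.AtomisticToContinuum.Crystallization.Theorems.FrustratedLawDichotomyCellF1cHost (RwF1c hout_F1c hnbh_F1c)
open Summit.AtomisticToContinuum.Crystallization.Theorems.FrustratedLawDichotomyCellF1cLists (far_of_not_mem_ballF1cc dist_of_not_mem_ballF1cc)

/-- ★ (hsep) `7/10`-separation of the strained column on `MF1c`, every `F` of the cell. -/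
theorem hsep_aF1c {F : Matrix (Fin 3) (Fin 3) ℝ} (hG : ∀ i j, |(F.transpose * F) i j - (if i = j then 1 else 0)| ≤ 1 / 1024) :
    ∀ z ∈ MF1c, ∀ z' ∈ MF1c, z ≠ z' → (7 / 10 : ℝ) ≤ dist (posL F (aF1 z)) (posL F (aF1 z')) := hsepc hG

/-- the complete-template norm row: `(1 + 3ε)·Σᵢ(T·z)ᵢ² ≤ (13 + 41/1024)²` on `MF1c` (one `norm_num` through `BLc`). -/
theorem row_of_admLc {m : ℤ × ℤ × ℤ} (h : qk m ≤ BLc) :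
    (1 + 3 * (1 / 1024 : ℝ)) * ∑ i, (T.mulVec (fun j => (zT m j : ℝ)) i) ^ 2 ≤ (13 + 41 / 1024) ^ 2 := by
  rw [sumSq_T]
  have h' : (qk m : ℝ) ≤ BLc := by exact_mod_cast h
  have hB : (1 + 3 * (1 / 1024 : ℝ)) * ((BLc : ℝ) / 16384 ^ 2) ≤ (13 + 41 / 1024) ^ 2 := by unfold BLc; norm_num
  refine le_trans ?_ hB
  exact mul_le_mul_of_nonneg_left (div_le_div_of_nonneg_right h' (by positivity)) (by norm_num)

/-- ★ every COMPLETE label is placed within `13 + 41/1024` of the root under every `F` of the strain cell (complete labels may exceed `Rc`). -/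
theorem norm_Mc_le_aF1 {F : Matrix (Fin 3) (Fin 3) ℝ} (hG : ∀ i j, |(F.transpose * F) i j - (if i = j then 1 else 0)| ≤ 1 / 1024) :
    ∀ m ∈ MF1c, ‖posL F (aF1 m)‖ ≤ 13 + 41 / 1024 :=
  fun m hm => norm_le_of_nearId hG (by norm_num) (row_of_admLc ((admLc_iff m).mp (mem_Mc.mp hm)).2)

/-- ★ (hout) window completeness of the complete cell at radius `RwF1c = Rc + τ`, named column. -/
theorem hout_aF1c {F : Matrix (Fin 3) (Fin 3) ℝ} (hG : ∀ i j, |(F.transpose * F) i j - (if i = j then 1 else 0)| ≤ 1 / 1024) :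
    ∀ x : ℤ × ℤ × ℤ, Even (sumT x) → x ∉ MF1c → RwF1c ≤ ‖posL F (aF1 x)‖ := hout_F1c hG

/-- ★ (hnbh) the mirror-host side condition over `MF1c` with a per-label dial `Lh`, `Lh m + ‖pos m‖ ≤ RwF1c`. -/
theorem hnbh_aF1c {F : Matrix (Fin 3) (Fin 3) ℝ} (hG : ∀ i j, |(F.transpose * F) i j - (if i = j then 1 else 0)| ≤ 1 / 1024)
    {Lh : ℤ × ℤ × ℤ → ℝ} (hLw : ∀ m ∈ MIF1, Lh m + ‖posL F (aF1 m)‖ ≤ RwF1c) :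
    ∀ m ∈ MIF1, ∀ m' ∈ MF1c, m' ≠ m → m' ∉ mirrorNbh MF1c mirT m → Lh m ≤ dist (posL F (aF1 m')) (posL F (aF1 m)) := hnbh_F1c hG hLw

/-- (hnbh) with a constant dial `L ≤ RwF1c − 4` (interior labels sit within `4` of the root). -/
theorem hnbh_aF1c_const {F : Matrix (Fin 3) (Fin 3) ℝ} (hG : ∀ i j, |(F.transpose * F) i j - (if i = j then 1 else 0)| ≤ 1 / 1024)
    {L : ℝ} (hL : L ≤ RwF1c - 4) :
    ∀ m ∈ MIF1, ∀ m' ∈ MF1c, m' ≠ m → m' ∉ mirrorNbh MF1c mirT m → L ≤ dist (posL F (aF1 m')) (posL F (aF1 m)) :=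
  hnbh_F1c hG (Lh := fun _ => L) fun m hm => by linarith [norm_MI_le hG m hm]

/-- the numeric instance `L = 9`: `9 ≤ RwF1c − 4` (the complete radius buys one unit over #90's `8`). -/
theorem nine_le_RwF1c_sub : (9 : ℝ) ≤ RwF1c - 4 := by unfold RwF1c; norm_num

/-- ★ the interior lies in the integer ball of radius `40` about the root inside `MF1c` (the `hMIA` shape of the (251) master, `ℓ_A := 40`). -/
theorem MI_subset_ballLc : MIF1 ⊆ ballL MF1c zT 40 (0 : ℤ × ℤ × ℤ) := by
  intro m hm
  rw [mem_ballL_zT]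
  refine ⟨MI_subset_Mc hm, ?_⟩
  have h := sqT_le_of_MI m hm
  have e : sqT (subT m 0) = sqT m := by simp [sqT, subT]
  omega

/-- ★ far conversion about the root over `MF1c`: outside the `ℓ`-ball ⇒ `L ≤ ‖pos m‖` whenever `L² ≤ (1 − 3ε)(2/5)ℓ`. -/
theorem far_aF1c {F : Matrix (Fin 3) (Fin 3) ℝ} (hG : ∀ i j, |(F.transpose * F) i j - (if i = j then 1 else 0)| ≤ 1 / 1024)
    {L : ℝ} {ℓ : ℤ} (hL : L ^ 2 ≤ (1 - 3 * (1 / 1024)) * (2 / 5) * ℓ) {m : ℤ × ℤ × ℤ} (hm : m ∈ MF1c)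
    (hn : m ∉ ballL MF1c zT ℓ (0 : ℤ × ℤ × ℤ)) : L ≤ ‖posL F (aF1 m)‖ := far_of_not_mem_ballF1cc hG hL hm hn

/-- far conversion about any label `c` over `MF1c`. -/
theorem dist_aF1c {F : Matrix (Fin 3) (Fin 3) ℝ} (hG : ∀ i j, |(F.transpose * F) i j - (if i = j then 1 else 0)| ≤ 1 / 1024)
    {L : ℝ} {ℓ : ℤ} (hL : L ^ 2 ≤ (1 - 3 * (1 / 1024)) * (2 / 5) * ℓ) {c m : ℤ × ℤ × ℤ} (hm : m ∈ MF1c) (hn : m ∉ ballL MF1c zT ℓ c) :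
    L ≤ dist (posL F (aF1 m)) (posL F (aF1 c)) := dist_of_not_mem_ballF1cc hG hL hm hn

end Summit.AtomisticToContinuum.Crystallization.Theorems.FrustratedLawDichotomyCellF1cPos
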